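import Mathlib
import Summits.NavierStokesRegularity.NavierStokesRegularity.Theorems.TaoLadderRungTwoBreakOneShiftWindowPairStepReal
import Summits.NavierStokesRegularity.NavierStokesRegularity.Theorems.TaoLadderRungTwoBreakOneShiftWindowStepDeviation
import Summits.NavierStokesRegularity.NavierStokesRegularity.Theorems.TaoLadderRungTwoBreakOneShiftWindowStepBootstrap
import Summits.NavierStokesRegularity.NavierStokesRegularity.Theorems.TaoLadderRungTwoBreakOneShiftWindowTwinSource
import HarnessLib

/-!
# The one-shift window system, LXVIII: THE TWO-RUN SENSITIVITY STEP FROM DYADIC DATA — one Boolean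
# `PairStepD.sensOK pY ZY pT ZT` that, when `true` (together with the pair-step test), yields for ANY two runs of two
# TWIN realisations (tail inputs at sup-distance `≤ δ`) starting `|S_u(0) − S_v(0)|_i ≤ pY_i d + pT_i δ` apart and
# staying in the hull: `|S_u(t) − S_v(t)|_i ≤ (pY_i + ZY_i) d + (pT_i + ZT_i) δ` on the step — part XVII
# `abs_stepSensitivity_le` fed by the rough Jacobian rows of part XXXIV and the twin source rows of part LXVII
# (cell harvest/h2-tao-ladder, seat p2; rung1/RUNG1-P2G16-REPORT.md §83 (K2); support for K1(1) = `NoSurvivingDSSOne`,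
# stmt-NavierStokesRegularity-20205)

MODEL lattice ODEs only (Tao 2016 §4 normal form on Tao's shift set `S`); nothing here is a statement about
the Navier–Stokes equations; no item is closed; no instance is evaluated here. Generic in `ι` (numbered by
`e : ι ≃ Fin n`) and `κ`; COMPUTATIONAL (referee P162) once an instance's Booleans are evaluated by `native_decide`.

THE DATA: four vectors `pY, ZY, pT, ZT : ℕ → Dyad` (start sensitivities in the point / in the tails, and their
within-step K–Z increments). THE COMPUTATION (`sensOK`): non-negativity, and the two Kapela–Zgliczyński vector fixed
points `((R_r ZY)_i + (Ab pY)_i) E_r,i ≤ ZY_i`, `((R_r ZT)_i + src_i + (Ab pT)_i) E_r,i ≤ ZT_i` over the hull `Hs` with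
the SAME sparse rough rows `R_r`, `Ab`, weights `E_r` and direction `ζ_r` as the growth test of part XXXIV
(`checkPair`), `src_i = mag (srcRow prec Hs row_i)` (part LXVII). THE THEOREM `PairStepD.abs_sens_le`.
-/

-- the sub-problem namespace repeats the summit name by design (D-0017)
set_option linter.dupNamespace false

namespace Summit.NavierStokesRegularity.NavierStokesRegularity.Theorems

namespace DSSOneShift

open Set Finset Metric Filter Topology TopologicalSpace
open Literature.Analysis.ODE
open Summit.NavierStokesRegularity.NavierStokesRegularity.Theorems.TaylorModelCert
open Summit.NavierStokesRegularity.NavierStokesRegularity.Theorems.TaylorModelReadout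
open Summit.NavierStokesRegularity.NavierStokesRegularity.Theorems.CertificateGlueOn

namespace PairStepD

variable (d : PairStepD)

/-! ### The data side -/

/-- The twin-source magnitude of row `c` over the hull: `src_c = |srcRow prec Hs row_c|`. [cite: KapelaZgliczynski2009, §4 (perturbation size); cell vocabulary, harvest/h2-tao-ladder rung1/RUNG1-P2G16-REPORT.md §83 (β)] -/
def srcD (c : ℕ) : Dyad := IntervalD.mag (srcRow d.prec d.Hs (d.row c))

/-- **THE SENSITIVITY TEST OF ONE STEP** for the four vectors `pY, ZY, pT, ZT`: non-negativity and the two K–Z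
vector fixed points `((R_r ZY)_i + (Ab pY)_i) E_r,i ≤ ZY_i`, `((R_r ZT)_i + src_i + (Ab pT)_i) E_r,i ≤ ZT_i`.
[cite: KapelaZgliczynski2009, §4 Lemma 8 / Thm. 9; cell vocabulary, harvest/h2-tao-ladder rung1/RUNG1-P2G16-REPORT.md §83 (SensStepD)] -/
def sensOK (pY ZY pT ZT : ℕ → Dyad) : Bool :=
  (List.range d.n).all fun i =>
    Dyad.ble (Dyad.ofInt 0) (pY i) && Dyad.ble (Dyad.ofInt 0) (ZY i) &&
    Dyad.ble (Dyad.ofInt 0) (pT i) && Dyad.ble (Dyad.ofInt 0) (ZT i) &&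
    IntervalD.hiLe
      (IntervalD.mulR d.prec (IntervalD.addR d.prec (d.rowDot (d.RrRow i) ZY) (d.rowDot (d.AbRow i) pY))
        (IntervalD.ofDyad (d.ER i)))
      (ZY i) &&
    IntervalD.hiLe
      (IntervalD.mulR d.prec
        (IntervalD.addR d.prec (d.rowDot (d.RrRow i) ZT)
          (IntervalD.addR d.prec (IntervalD.ofDyad (d.srcD i)) (d.rowDot (d.AbRow i) pT)))
        (IntervalD.ofDyad (d.ER i)))
      (ZT i)

/-- What `sensOK = true` says. [folklore] -/
theorem of_sensOK {pY ZY pT ZT : ℕ → Dyad} (h : d.sensOK pY ZY pT ZT = true) : ∀ i < d.n,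
    0 ≤ (pY i).toReal ∧ 0 ≤ (ZY i).toReal ∧ 0 ≤ (pT i).toReal ∧ 0 ≤ (ZT i).toReal ∧
    IntervalD.hiLe
      (IntervalD.mulR d.prec (IntervalD.addR d.prec (d.rowDot (d.RrRow i) ZY) (d.rowDot (d.AbRow i) pY))
        (IntervalD.ofDyad (d.ER i)))
      (ZY i) = true ∧
    IntervalD.hiLe
      (IntervalD.mulR d.prec
        (IntervalD.addR d.prec (d.rowDot (d.RrRow i) ZT)
          (IntervalD.addR d.prec (IntervalD.ofDyad (d.srcD i)) (d.rowDot (d.AbRow i) pT)))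
        (IntervalD.ofDyad (d.ER i)))
      (ZT i) = true := by
  unfold sensOK at h
  simp only [Bool.and_eq_true, List.all_eq_true, List.mem_range] at h
  intro i hi
  obtain ⟨⟨⟨⟨⟨h1, h2⟩, h3⟩, h4⟩, h5⟩, h6⟩ := h i hi
  exact ⟨by simpa using (Dyad.ble_iff _ _).1 h1, by simpa using (Dyad.ble_iff _ _).1 h2,
    by simpa using (Dyad.ble_iff _ _).1 h3, by simpa using (Dyad.ble_iff _ _).1 h4, h5, h6⟩

/-! ### Soundness -/

variable {ι : Type*} [Fintype ι] [DecidableEq ι] {κ : Type*} [Fintype κ] (e : ι ≃ Fin d.n)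

/-- **THE TWO-RUN SENSITIVITY OF ONE STEP FROM THE DATA.** The pair-step test and the sensitivity test passed; `S_u`,
`S_v` are runs on `[0, h']`, `h' ≤ h`, of two rough realisations `Tf₁`, `Tf₂` of the step's term data that are TWINS at
distance `δ ≥ 0` (part LXVII), both staying in the hull `Hs` on `[0, h')`, and `|S_u(0) − S_v(0)|_i ≤ pY_i d + pT_i δ`
(`d ≥ 0`). Then `|S_u(t) − S_v(t)|_i ≤ (pY_i + ZY_i) d + (pT_i + ZT_i) δ` for all `t ∈ [0, h']` (part XVII
`abs_stepSensitivity_le` with `B := d`, `E := δ`, `cb := 0`, `ce := src`, the rough rows of part XXXIV and the weights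
`E_r`, direction `ζ_r` of the growth test). [cite: KapelaZgliczynski2009, §4 Lemma 8 / Thm. 9; WalawskaWilczak2016, §2.2 Lemma 2; cell vocabulary, harvest/h2-tao-ladder rung1/RUNG1-P2G16-REPORT.md §83 (K2), rung1/KERNEL-CHEAP-REPLAY-SPEC.md §3 S5] -/
theorem abs_sens_le {Tc : κ → BTerm ι} {Tf₁ Tf₂ : ℝ → κ → BTerm ι} {rows : ι → List κ}
    (hRDc : IsRTEncl e Tc Tc rows d.RD)
    {h' : ℝ} (hh' : h' ∈ Icc 0 d.hD.toReal)
    (hRD₁ : ∀ t ∈ Ico 0 h', IsRTEncl e Tc (Tf₁ t) rows d.RD)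
    (hRD₂ : ∀ t ∈ Ico 0 h', IsRTEncl e Tc (Tf₂ t) rows d.RD)
    {δ : ℝ} (hδ : 0 ≤ δ)
    (htwin : ∀ t ∈ Ico 0 h', ∀ k, Factor.Twin δ (Tf₁ t k).fa (Tf₂ t k).fa ∧ Factor.Twin δ (Tf₁ t k).fb (Tf₂ t k).fb)
    (hc : d.check = true) {pY ZY pT ZT : ℕ → Dyad} (hs : d.sensOK pY ZY pT ZT = true)
    (hmemH : ∀ x ∈ boxSet (boxOf e d.Hs), ∀ i, IntervalD.mem (x i) (IntervalD.aget d.Hs (e i)))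
    {dd : ℝ} (hdd : 0 ≤ dd) {Su Sv : ℝ → ι → ℝ}
    (hSu : ∀ t ∈ Icc 0 h', HasDerivWithinAt Su (termField (Tf₁ t) (Su t)) (Icc 0 h') t)
    (hSv : ∀ t ∈ Icc 0 h', HasDerivWithinAt Sv (termField (Tf₂ t) (Sv t)) (Icc 0 h') t)
    (hmem : ∀ t ∈ Ico 0 h', Su t ∈ boxSet (boxOf e d.Hs) ∧ Sv t ∈ boxSet (boxOf e d.Hs))
    (h0 : ∀ i, |Su 0 i - Sv 0 i| ≤ (pY (e i)).toReal * dd + (pT (e i)).toReal * δ) :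
    ∀ t ∈ Icc 0 h', ∀ i, |Su t i - Sv t i| ≤
      ((pY (e i)).toReal + (ZY (e i)).toReal) * dd + ((pT (e i)).toReal + (ZT (e i)).toReal) * δ := by
  classical
  have hc' : d.toRoughStepD.check = true ∧ d.checkPair = true := by simpa [check, Bool.and_eq_true] using hc
  obtain ⟨hrc, hpc⟩ := hc'
  have hrc' : d.toRoughStepD.centre.check = true ∧ d.toRoughStepD.checkKZ = true := by
    simpa [RoughStepD.check, Bool.and_eq_true] using hrc
  have hcw := d.toRoughStepD.centre.of_checkWith (by rw [← CentreStepD.check_eq]; exact hrc'.1)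
  have hh : 0 ≤ d.hD.toReal := hcw.2.1
  have hP := d.of_checkPair hpc
  have hS := d.of_sensOK hs
  have hrow : ∀ i, List.Forall₂ (fun dd k => TermOK e dd (Tc k) (Tc k)) (d.row (e i)) (rows i) := d.rowOK e hRDc
  have hvAb : ∀ i, ∀ p ∈ d.AbRow (e i), p.1 < d.n := fun i => fst_lt_of_mem_magRow e d.prec (RFac.rval d.Hs) (hrow i)
  have hvRr : ∀ i, ∀ p ∈ d.RrRow (e i), p.1 < d.n := fun i => fst_lt_of_mem_filter (hvAb i) _
  -- rough data, read through `e`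
  let dgr : ι → ℝ := fun i => (d.dgR (e i)).toReal
  let Rr : ι → ι → ℝ := fun i j => colVal (d.RrRow (e i)) (e j)
  let Ab : ι → ι → ℝ := fun i j => colVal (d.AbRow (e i)) (e j)
  let Er : ι → ℝ := fun i => (d.ER (e i)).toReal
  let ζr : ι → ℝ := fun i => (RoughStepD.dget d.zetaR (e i)).toReal
  let src : ι → ℝ := fun i => (d.srcD (e i)).toReal
  let pYr : ι → ℝ := fun i => (pY (e i)).toReal
  let ZYr : ι → ℝ := fun i => (ZY (e i)).toReal
  let pTr : ι → ℝ := fun i => (pT (e i)).toReal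
  let ZTr : ι → ℝ := fun i => (ZT (e i)).toReal
  -- sparse products
  have hsumRr : ∀ i (g : ℕ → Dyad), IntervalD.mem (∑ j, Rr i j * (g (e j)).toReal) (d.rowDot (d.RrRow (e i)) g) := by
    intro i g
    have hs' := sum_colVal_mul e (fun c => (g c).toReal) (hvRr i)
    show IntervalD.mem (∑ j, colVal (d.RrRow (e i)) (e j) * (g (e j)).toReal) _
    rw [hs']
    exact d.mem_rowDot g (d.RrRow (e i))
  have hsumAb : ∀ i (g : ℕ → Dyad), IntervalD.mem (∑ j, Ab i j * (g (e j)).toReal) (d.rowDot (d.AbRow (e i)) g) := by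
    intro i g
    have hs' := sum_colVal_mul e (fun c => (g c).toReal) (hvAb i)
    show IntervalD.mem (∑ j, colVal (d.AbRow (e i)) (e j) * (g (e j)).toReal) _
    rw [hs']
    exact d.mem_rowDot g (d.AbRow (e i))
  -- Jacobian bounds of the first realisation on the hull
  have hIco : ∀ t ∈ Ico 0 h', t ∈ Ico 0 d.hD.toReal := fun t ht => ⟨ht.1, lt_of_lt_of_le ht.2 hh'.2⟩
  have hdg : ∀ t ∈ Ico 0 h', ∀ x ∈ boxSet (boxOf e d.Hs), ∀ i,
      (termFieldDeriv (Tf₁ t) x) (Pi.single i 1) i ≤ dgr i := by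
    intro t ht x hx i
    rw [termFieldDeriv_single]
    exact (mem_jacEntry_jacRowR e (hRD₁ t ht) d.prec (hmemH _ hx) i i).2
  have hR : ∀ t ∈ Ico 0 h', ∀ x ∈ boxSet (boxOf e d.Hs), ∀ i j, i ≠ j →
      |(termFieldDeriv (Tf₁ t) x) (Pi.single j 1) i| ≤ Rr i j := by
    intro t ht x hx i j hij
    rw [termFieldDeriv_single]
    show |jacEntry (Tf₁ t) x i j| ≤ colVal (d.RrRow (e i)) (e j)
    rw [PairStepD.RrRow, colVal_filter_ne (fun h'' => hij (e.injective (Fin.ext h'')).symm)]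
    exact abs_jacEntry_le_colVal_rough e (hRD₁ t ht) d.prec (hmemH _ hx) i j
  have hAbb : ∀ t ∈ Ico 0 h', ∀ x ∈ boxSet (boxOf e d.Hs), ∀ i j,
      |(termFieldDeriv (Tf₁ t) x) (Pi.single j 1) i| ≤ Ab i j := by
    intro t ht x hx i j
    rw [termFieldDeriv_single]
    exact abs_jacEntry_le_colVal_rough e (hRD₁ t ht) d.prec (hmemH _ hx) i j
  -- the twin field difference on the hull
  have hδf : ∀ t ∈ Ico 0 h', ∀ x ∈ boxSet (boxOf e d.Hs), ∀ i,
      |termField (Tf₁ t) x i - termField (Tf₂ t) x i| ≤ (0 : ℝ) * dd + src i * δ := by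
    intro t ht x hx i
    rw [zero_mul, zero_add]
    exact abs_termField_twin_sub_le e (hRD₁ t ht) (hRD₂ t ht) hδ (htwin t ht) d.prec (hmemH _ hx) i
  -- weights and direction
  have hEr : ∀ i, gronwallBound 0 (dgr i) 1 h' ≤ Er i := by
    intro i
    have hx := (hP (e i) (e i).isLt).2.1
    simp only [PairStepD.xplusR, Dyad.toReal_max, Dyad.toReal_mul, Dyad.toReal_ofInt, Int.cast_zero, max_le_iff] at hx
    refine (gronwallBound_mono_time hh'.2).trans ((gronwallBound_le_lin hh hx.1).trans (le_of_eq ?_))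
    simp only [Er, PairStepD.ER, PairStepD.xplusR, Dyad.toReal_mul, Dyad.toReal_add, Dyad.toReal_max, Dyad.toReal_ofInt]
    push_cast; ring
  have hdir : ∀ i, (∑ j, Rr i j * ζr j) * Er i ≤ ζr i := by
    intro i
    have hok := (hP (e i) (e i).isLt).2.2.2.1
    exact IntervalD.le_of_hiLe hok (IntervalD.mem_mulR d.prec (hsumRr i (RoughStepD.dget d.zetaR)) (IntervalD.mem_ofDyad _))
  -- the two fixed points
  have hfixY : ∀ i, ((∑ j, Rr i j * ZYr j) + ((0 : ℝ) + ∑ j, Ab i j * pYr j)) * Er i ≤ ZYr i := by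
    intro i
    rw [zero_add]
    have hok := (hS (e i) (e i).isLt).2.2.2.2.1
    exact IntervalD.le_of_hiLe hok (IntervalD.mem_mulR d.prec
      (IntervalD.mem_addR d.prec (hsumRr i ZY) (hsumAb i pY)) (IntervalD.mem_ofDyad _))
  have hfixT : ∀ i, ((∑ j, Rr i j * ZTr j) + (src i + ∑ j, Ab i j * pTr j)) * Er i ≤ ZTr i := by
    intro i
    have hok := (hS (e i) (e i).isLt).2.2.2.2.2
    exact IntervalD.le_of_hiLe hok (IntervalD.mem_mulR d.prec
      (IntervalD.mem_addR d.prec (hsumRr i ZT) (IntervalD.mem_addR d.prec (IntervalD.mem_ofDyad _) (hsumAb i pT)))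
      (IntervalD.mem_ofDyad _))
  -- part XVII
  have hres := abs_stepSensitivity_le (ι := ι) (h := h') hh'.1 (convex_boxSet (boxOf e d.Hs))
    (f := fun t x => termField (Tf₁ t) x) (f₂ := fun t x => termField (Tf₂ t) x)
    (f' := fun t x => termFieldDeriv (Tf₁ t) x) (S := Su) (S₂ := Sv) hSu hSv hmem
    (fun t _ x _ => hasFDerivWithinAt_termField (Tf₁ t) (boxSet (boxOf e d.Hs)) x)
    (dg := dgr) (cb := fun _ => 0) (ce := src) (pb := pYr) (pe := pTr) (Zb := ZYr) (Ze := ZTr) (Ew := Er) (ζ := ζr)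
    (R := Rr) (Ab := Ab) (B := dd) (E := δ) hdd hδ hdg
    (fun i j => colVal_filter_nonneg (snd_nonneg_of_mem_magRow d.prec _ _) _ _) hR
    (fun i j => colVal_magRow_nonneg d.prec _ _ _) hAbb
    (fun _ => le_rfl) (fun i => by
      show 0 ≤ (d.srcD (e i)).toReal
      exact srcRow_mag_nonneg d.prec d.Hs (d.row (e i)))
    (fun i => (hS (e i) (e i).isLt).1) (fun i => (hS (e i) (e i).isLt).2.2.1) h0 hδf
    (fun i => (hS (e i) (e i).isLt).2.1) (fun i => (hS (e i) (e i).isLt).2.2.2.1) hEr hfixY hfixT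
    (fun i => (hP (e i) (e i).isLt).1) hdir
  intro t ht i
  exact hres t ht i

end PairStepD

end DSSOneShift

end Summit.NavierStokesRegularity.NavierStokesRegularity.Theorems
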